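import Summits.HodgeConjecture.HodgeConjecture.Theorems.MarkmanPartnerTransportPicardThreeK3SquaresRMTypeOpenEigenvalue
import HarnessLib

/-!
# Route MarkmanPartnerTransport · crux `PicardThreeK3Squares` (stmt-HodgeConjecture-19652) —
# the displayed input `RMTypeOpen θ` from data at a single eigenvalue

Cell hodge-nonav, crux #4 (HC⁴(S ⊗ S), ρ(S) ≥ 3; open core: real multiplication), programme «RATIONAL ORBIT
DENSITY» (prover seat hodge-nonav-19652-p1 gen 10; `--supports stmt-HodgeConjecture-19652`, helper).
Fact-free; credits nothing; nothing here says HC is proved.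

`rmTypeOpen_of_open_at`: the displayed Prop `RMTypeOpen θ` (`…RMTypeOpenDefs`) quantifies over EVERY
eigenvalue `e` whose Hodge locus `D_{θ,e}` carries a `θ`-generic period point. For a real-multiplication type
only ONE eigenvalue does: an eigenvalue carrying a period point is REAL (`star_eigenvalue_eq`), it is non-zero
as soon as the kernel of `θ_ℂ` carries no period point (displayed: for a K3 type `ker θ = NS` is hyperbolic),
and two non-zero real eigenvalues carrying period points COINCIDE when `θ` kills a rational vector of
positive square (`eigenvalue_eq_of_periodPts`, signature `(3,19)`). Hence `RMTypeOpen θ` follows from the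
open-set input at a single eigenvalue `e₀ ≠ 0` (`Open[θ, e₀]`) together with one period point of `D_{θ,e₀}`,
one positive rational kernel vector, and «no period point in `ker θ_ℂ`». APPENDED:
`hodgeConjectureFor_square_of_exists_on_open_at_of_isK3Surface` — (T‴) with `IsK3Surface S` in place of the RM
datum (mod Buskin + the displayed ∃-form input). No definition, no sorry.

References: van Geemen–Schütt, Forum Math. Sigma 13 (2025) e2, §2.1, §3.4; Huybrechts, *Lectures on K3
Surfaces*, Ch. 6 Prop. 1.5, Ch. 14 §0.3 (vi).
-/

set_option linter.dupNamespace false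

noncomputable section

namespace Summit.HodgeConjecture.HodgeConjecture.Theorems.MarkmanPartnerTransport.RMTypeOrbit

open CategoryTheory MonoidalCategory Polynomial
open Literature.AlgebraicGeometry Literature.AlgebraicGeometry.Motives Literature.AlgebraicGeometry.HodgeTheory
open Literature.AlgebraicGeometry.Surfaces Literature.LinearAlgebra.QuadraticForm
open Literature.AlgebraicTopology.SingularHomology
open Summit.HodgeConjecture.HodgeConjecture.Theorems.NikulinTwinTransport
open Summit.HodgeConjecture.HodgeConjecture.Theorems.MarkmanPartnerTransport.IsogenyInvariance
open Summit.HodgeConjecture.HodgeConjecture.Theorems.MarkmanPartnerTransport.RMTypeDescent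

/-- `MarkedK3[S, η, p, x]`: VERBATIM the `let MarkedK3 := …` binder of the route declaration
`PicardThreeK3Squares` (as in `…RMTypeDescent`). Local notation only. -/
local notation3 (prettyPrint := false) "MarkedK3[" S ", " η ", " p ", " x "]" =>
  (p ≠ 0 ∧ (IsIntegralClass p ∧
    (∀ q : complexBetti S (2 * 2), IsIntegralClass q → ∃ n : ℤ, q = n • p) ∧
    (∀ c : complexBetti S (2 * 1), IsIntegralClass c ↔ ∃ v : K3Index → ℤ, η c = fun i => (v i : ℂ)) ∧
    (∀ a b : complexBetti S (2 * 1),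
      cupProduct (rfl : 2 * 1 + 2 * 1 = 2 * 2) a b = k3Form (η a) (η b) • p) ∧
    IsOfHodgeType 2 S (2 * 1) 2 0 (LinearEquiv.symm η x) ∧
    (∀ τ : complexBetti S (2 * 1), IsOfHodgeType 2 S (2 * 1) 2 0 τ →
      ∃ t : ℂ, τ = t • LinearEquiv.symm η x)) ∧
    (k3Form x x = 0 ∧ 0 < (k3Form (star x) x).re ∧
      ∃ u : K3Index → ℤ, k3Form (fun i => (u i : ℂ)) x = 0 ∧ 0 < ∑ i, ∑ j, u i * k3Gram i j * u j))

/-- `Cycle[θ, e, U]`: **`θ` is cycle-induced on the open set `U` of the Hodge locus `D_{θ,e}`** — every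
marked projective K3 surface `(S', η', p', y)` whose period `y ∈ U` is a `θ`-generic `e`-eigenvector of
`θ_ℂ` carries an algebraic class on `S' × S'` inducing `η'⁻¹ θ_ℂ η'`. Local notation only. -/
local notation3 (prettyPrint := false) "Cycle[" θ ", " e ", " U "]" =>
  (∀ (S' : SchemeOver ℂ) (hS' : IsK3Surface S') (η' : complexBetti S' (2 * 1) ≃ₗ[ℂ] (K3Index → ℂ))
    (p' : complexBetti S' (2 * 2)) (y : K3Index → ℂ), y ∈ U → MarkedK3[S', η', p', y] →
    thetaC θ y = (e : ℂ) • y →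
    (∀ v : K3Index → ℚ, k3Form (fun i => (v i : ℂ)) y = 0 → Matrix.mulVec θ v = 0) →
    ∃ γ' ∈ algebraicClasses (S' ⊗ S') 2, ∀ z : complexBetti S' (2 * 1),
      (η'.symm.toLinearMap ∘ₗ (thetaC θ ∘ₗ η'.toLinearMap)) z =
        complexGysin complexOrientationFamily
          (IsSmoothProjective.tensor_holds hS'.isSmoothProjective hS'.isSmoothProjective)
          hS'.isSmoothProjective (SemiCartesianMonoidalCategory.fst S' S')
          (rfl : 2 * 1 + 2 * 2 + 2 * 2 = 2 * 1 + 2 * (2 + 2))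
          (cupProduct (rfl : 2 * 1 + 2 * 2 = 2 * 1 + 2 * 2)
            (complexBetti.map (SemiCartesianMonoidalCategory.snd S' S') (2 * 1) z) γ'))

/-- `Open[θ, e]`: **the RM type `θ` is cycle-induced on an open set of its Hodge locus at the
eigenvalue `e`** — as soon as `D_{θ,e}` contains a `θ`-generic period point, some OPEN `U ⊂ Λ_ℂ` meets
`D_{θ,e}` and `θ` is cycle-induced on `U` (`Cycle[θ, e, U]`). This is the `e`-component of the displayed
input `RMTypeOpen θ` (`…RMTypeOpenDefs`). Local notation only. -/
local notation3 (prettyPrint := false) "Open[" θ ", " e "]" =>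
  (∀ y₀ : K3Index → ℂ, thetaC θ y₀ = (e : ℂ) • y₀ → k3Form y₀ y₀ = 0 → 0 < (k3Form (star y₀) y₀).re →
    (∀ v : K3Index → ℚ, k3Form (fun i => (v i : ℂ)) y₀ = 0 → Matrix.mulVec θ v = 0) →
    ∃ U : Set (K3Index → ℂ), IsOpen U ∧
      (∃ y₁ ∈ U, thetaC θ y₁ = (e : ℂ) • y₁ ∧ k3Form y₁ y₁ = 0 ∧ 0 < (k3Form (star y₁) y₁).re) ∧
      Cycle[θ, e, U])

variable {θ : Matrix K3Index K3Index ℚ}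

/-- **The displayed input `RMTypeOpen θ` from data at ONE eigenvalue.** Let `θ` be `k3Form`-self-adjoint,
killing a rational vector of positive square and admitting NO period point in its kernel (for a K3 real-
multiplication type: `ker θ = NS` is hyperbolic). If `D_{θ,e₀}` (`e₀ ≠ 0` real) contains a period point
`y₁` and `θ` is cycle-induced on an open set of `D_{θ,e₀}` in the sense of the `e₀`-clause of
`RMTypeOpen θ`, then `RMTypeOpen θ`: every eigenvalue `e` carrying a period point is real
(`star_eigenvalue_eq`), non-zero (no period point in the kernel), hence `= e₀`
(`eigenvalue_eq_of_periodPts`). [cite: GeemenSchutt2023, §2.1 and §3.4]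
[cite: Huybrechts2016K3, Ch. 6 Prop. 1.5 and Ch. 14 §0.3 (vi)] -/
theorem rmTypeOpen_of_open_at
    (hθsa : ∀ a b : K3Index → ℂ, k3Form (thetaC θ a) b = k3Form a (thetaC θ b))
    (hu : ∃ u : K3Index → ℚ, θ.mulVec u = 0 ∧ 0 < k3FormRat u u)
    (hker : ∀ y : K3Index → ℂ, thetaC θ y = 0 → k3Form y y = 0 → ¬ 0 < (k3Form (star y) y).re)
    {e₀ : ℝ} (he₀ : e₀ ≠ 0) {y₁ : K3Index → ℂ} (hy₁ : thetaC θ y₁ = (e₀ : ℂ) • y₁)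
    (h₁₁ : k3Form y₁ y₁ = 0) (h₁p : 0 < (k3Form (star y₁) y₁).re)
    (hOpen : Open[θ, e₀]) : RMTypeOpen θ := by
  intro e y₀ hy₀ h₀₀ h₀p hgen
  have hstar : star e = e := star_eigenvalue_eq hθsa hy₀ h₀p
  have hee : ((e.re : ℝ) : ℂ) = e := Complex.conj_eq_iff_re.1 hstar
  have hre0 : e.re ≠ 0 := by
    intro hz
    have he0 : e = 0 := by rw [← hee, hz, Complex.ofReal_zero]
    rw [he0, zero_smul] at hy₀
    exact hker y₀ hy₀ h₀₀ h₀p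
  have hy₀' : thetaC θ y₀ = ((e.re : ℝ) : ℂ) • y₀ := by rw [hee]; exact hy₀
  have heq : e.re = e₀ := eigenvalue_eq_of_periodPts hθsa hu hre0 he₀ hy₀' h₀₀ h₀p hy₁ h₁₁ h₁p
  have he : e = (e₀ : ℂ) := by rw [← hee, heq]
  subst he
  exact hOpen y₀ hy₀ h₀₀ h₀p hgen

/-- `CycleEx[θ, e, U]`: the ∃-form of `Cycle[θ, e, U]` — at every `θ`-generic period point of `D_{θ,e}`
in `U` there EXISTS a marked projective K3 surface carrying an algebraic class inducing `η'⁻¹ θ_ℂ η'` (the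
shape of a family fact: «every period in the open period set of the family is the period of a member, and
every member carries the cycle»). Local notation only. -/
local notation3 (prettyPrint := false) "CycleEx[" θ ", " e ", " U "]" =>
  (∀ y : K3Index → ℂ, y ∈ U → thetaC θ y = (e : ℂ) • y → k3Form y y = 0 → 0 < (k3Form (star y) y).re →
    (∀ v : K3Index → ℚ, k3Form (fun i => (v i : ℂ)) y = 0 → Matrix.mulVec θ v = 0) →
    ∃ (S' : SchemeOver ℂ) (hS' : IsK3Surface S') (η' : complexBetti S' (2 * 1) ≃ₗ[ℂ] (K3Index → ℂ))
      (p' : complexBetti S' (2 * 2)), MarkedK3[S', η', p', y] ∧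
      ∃ γ' ∈ algebraicClasses (S' ⊗ S') 2, ∀ z : complexBetti S' (2 * 1),
        (η'.symm.toLinearMap ∘ₗ (thetaC θ ∘ₗ η'.toLinearMap)) z =
          complexGysin complexOrientationFamily
            (IsSmoothProjective.tensor_holds hS'.isSmoothProjective hS'.isSmoothProjective)
            hS'.isSmoothProjective (SemiCartesianMonoidalCategory.fst S' S')
            (rfl : 2 * 1 + 2 * 2 + 2 * 2 = 2 * 1 + 2 * (2 + 2))
            (cupProduct (rfl : 2 * 1 + 2 * 2 = 2 * 1 + 2 * 2)
              (complexBetti.map (SemiCartesianMonoidalCategory.snd S' S') (2 * 1) z) γ'))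

variable {S : SchemeOver ℂ}

/-- **(T‴) for an arbitrary K3 surface** — as `hodgeConjectureFor_square_of_exists_on_open_at` but with
`IsK3Surface S` in place of the RM datum `IsRealMultiplicationK3 S ρ P` (only the K3 property was used): a
marked projective K3 surface `S` with an endomorphism `t` (rational, type-preserving, killing `N¹`, image
`⊥ N¹`, `P(t) = 0` on `T` for a separable `P` with `P(0) ≠ 0`, generating `End_Hdg T(S)`) conjugate by a
rational isometry to the self-adjoint model `θ`, and `θ` cycle-induced (∃-form) on an open set of `D_{θ,e₀}`
⟹ `HodgeConjectureFor 4 (S ⊗ S)`. Mod `Buskin2019_hodgeIsometry_algebraic` and the displayed input only;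
credits nothing. [cite: GeemenSchutt2023, §2.1, §3.4 and §4.8] [cite: Buskin2019, Thm. 1.1]
[cite: Huybrechts2016K3, Ch. 6 Prop. 1.5 and Ch. 14 §0.3 (vi)] -/
theorem hodgeConjectureFor_square_of_exists_on_open_at_of_isK3Surface
    (hB : Buskin2019_hodgeIsometry_algebraic)
    (hθsa : ∀ a b : K3Index → ℂ, k3Form (thetaC θ a) b = k3Form a (thetaC θ b))
    {e₀ : ℝ} (he₀ : e₀ ≠ 0) {U : Set (K3Index → ℂ)} (hU : IsOpen U)
    {y₁ : K3Index → ℂ} (hy₁U : y₁ ∈ U) (hy₁ : thetaC θ y₁ = (e₀ : ℂ) • y₁) (h₁₁ : k3Form y₁ y₁ = 0)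
    (h₁p : 0 < (k3Form (star y₁) y₁).re) (hcyc : CycleEx[θ, e₀, U])
    {S : SchemeOver ℂ} (hS : IsK3Surface S) {P : ℚ[X]} (hPsep : P.Separable) (hP0 : P.eval 0 ≠ 0)
    (η : complexBetti S (2 * 1) ≃ₗ[ℂ] (K3Index → ℂ)) (p : complexBetti S (2 * 2)) (x : K3Index → ℂ)
    (hM : MarkedK3[S, η, p, x])
    (t : complexBetti S (2 * 1) →ₗ[ℂ] complexBetti S (2 * 1))
    (ht_rat : ∀ y, IsRationalClass y → IsRationalClass (t y))
    (ht_typ : ∀ (i j : ℕ) (y : complexBetti S (2 * 1)),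
      IsOfHodgeType 2 S (2 * 1) i j y → IsOfHodgeType 2 S (2 * 1) i j (t y))
    (ht_N : ∀ d ∈ algebraicClasses S 1, t d = 0)
    (ht_perp : ∀ (y : complexBetti S (2 * 1)), ∀ d ∈ algebraicClasses S 1,
      cupProduct (rfl : 2 * 1 + 2 * 1 = 2 * 2) (t y) d = 0)
    (hP : IsAnnihilatedOnTranscendentalBy S t P) (hgen : TranscendentalEndomorphismsGeneratedBy S t)
    (σ : Module.End ℂ (K3Index → ℂ)) (hσ : ∀ a b, k3Form (σ a) (σ b) = k3Form a b)
    (hσrat : ∀ v : K3Index → ℤ, ∃ w : K3Index → ℚ, σ (fun i => (v i : ℂ)) = fun i => (w i : ℂ))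
    (hconj : ∀ c : complexBetti S (2 * 1), σ (η (t c)) = thetaC θ (σ (η c))) :
    HodgeConjectureFor 4 (S ⊗ S) := by
  classical
  have hHT : Huybrechts_K3_hodgeTypes_H2 := Huybrechts_K3_hodgeTypes_H2_holds
  obtain ⟨hgenσ, hw⟩ := generic_and_posKernel_of_marking hS η p x hM t ht_N σ hσ hσrat hconj
  obtain ⟨hp0, ⟨hpint, hpgen, hηint, hηcup, h20, hline⟩, hPer⟩ := hM
  have hxpos : 0 < (k3Form (star x) x).re := hPer.2.1
  have hx0 : η.symm x ≠ 0 := fun h0 =>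
    ne_zero_of_star_self_re_pos hxpos (by simpa using congrArg η h0)
  -- the `(2,0)`-eigenvalue `e'` of `t`: real, a root of `P`, non-zero
  obtain ⟨e', he'⟩ := hline (t (η.symm x)) (ht_typ 2 0 _ h20)
  have heig' : thetaC θ (σ x) = e' • σ x := by
    have h1 := hconj (η.symm x)
    rw [he', map_smul, LinearEquiv.apply_symm_apply, map_smul] at h1
    exact h1.symm
  have hPσ := periodPt_ratIsometry σ hσ hσrat hPer
  have hstar : star e' = e' := star_eigenvalue_eq hθsa heig' hPσ.2.1
  have hee : ((e'.re : ℝ) : ℂ) = e' := Complex.conj_eq_iff_re.1 hstar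
  set PC : ℂ[X] := P.map (algebraMap ℚ ℂ) with hPC
  have htransc : ∀ d ∈ algebraicClasses S 1, cupProduct (rfl : 2 * 1 + 2 * 1 = 2 * 2) (η.symm x) d = 0 := by
    intro d hd
    obtain ⟨-, -, h3⟩ := hHT S hS (η.symm x) h20 hx0
    have h11 : IsOfHodgeType 2 S (2 * 1) 1 1 d :=
      isOfHodgeType_of_mem_algebraicClasses_of_isSmoothProjective hS.isSmoothProjective 1 hd
    have hds := ((h3 d).1 h11).1
    rw [cupProduct_gradedComm_holds ℂ _ (rfl : 2 * 1 + 2 * 1 = 2 * 2) rfl]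
    norm_num
    exact hds
  have hroot : PC.IsRoot e' := by
    have h1 := hP (η.symm x) htransc
    rw [← hPC, aeval_apply_of_eigen he', smul_eq_zero] at h1
    exact h1.resolve_right hx0
  have he'0 : e'.re ≠ 0 := by
    intro hz
    have h0 : e' = 0 := by rw [← hee, hz, Complex.ofReal_zero]
    have h1 : PC.eval 0 = 0 := by
      have h2 : PC.eval e' = 0 := hroot
      rwa [h0] at h2
    rw [hPC, Polynomial.eval_map, Polynomial.eval₂_at_zero, map_eq_zero_iff _ (algebraMap ℚ ℂ).injective,
      Polynomial.coeff_zero_eq_eval_zero] at h1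
    exact hP0 h1
  -- the Hodge locus of `θ` lives in one eigenvalue: `e'.re = e₀`
  have heq : e'.re = e₀ :=
    eigenvalue_eq_of_periodPts hθsa hw he'0 he₀ (by rw [hee]; exact heig') hPσ.1 hPσ.2.1 hy₁ h₁₁ h₁p
  have hee₀ : (e₀ : ℂ) = e' := by rw [← heq]; exact hee
  -- annihilation and certificate at `e₀`
  have htP : aeval t (X * PC) = 0 := by
    refine LinearMap.ext fun y => ?_
    rw [mul_comm X PC, map_mul, aeval_X, Module.End.mul_apply, LinearMap.zero_apply]
    exact hP (t y) (ht_perp y)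
  have hσsurj : Function.Surjective σ :=
    LinearMap.surjective_of_injective (injective_of_k3Form_isometry σ hσ)
  have hθP : aeval (thetaC θ) (X * PC) = 0 := by
    refine LinearMap.ext fun y => ?_
    obtain ⟨z, rfl⟩ := hσsurj y
    obtain ⟨c, rfl⟩ : ∃ c, η c = z := ⟨η.symm z, η.apply_symm_apply z⟩
    rw [LinearMap.zero_apply, ← conj_aeval_apply η t σ hconj, htP, LinearMap.zero_apply, map_zero, map_zero]
  obtain ⟨π, hπe, hπW⟩ := exists_eigenprojector_certificate (thetaC θ) (hPsep.map) hθP hroot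
  rw [← hee₀] at hπe hπW he'
  exact hodgeConjectureFor_square_of_exists_on_open hB hθsa he₀ hπe hπW
    (fun _ _ _ _ _ => ⟨U, hU, ⟨y₁, hy₁U, hy₁, h₁₁, h₁p⟩, hcyc⟩) hS η p x
    ⟨hp0, ⟨hpint, hpgen, hηint, hηcup, h20, hline⟩, hPer⟩ t ht_rat ht_N he' hgen σ hσ hσrat hconj

end Summit.HodgeConjecture.HodgeConjecture.Theorems.MarkmanPartnerTransport.RMTypeOrbit

end
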